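import Summits.Langlands.Langlands.Theorems.IrreducibilityBySelfDualityReciprocityUpToIrreducibilityRSupercuspidalFloor
import Summits.Langlands.Langlands.Theorems.IrreducibilityBySelfDualityReciprocityUpToIrreducibilityRIrreducibleEulerTrivial
import Summits.Langlands.Langlands.Theorems.DyadicOddResidueSectorComplementStubEulerFactorIso
import Summits.Langlands.Langlands.Theorems.DyadicOddResidueSectorComplementStubAutomorphicTwistData
import Literature.NumberTheory.GaloisRepresentations.HenniartGaloisSideCharacterisation
import Literature.NumberTheory.Automorphic.LocalLanglandsGLOne
import Literature.NumberTheory.Automorphic.RankinSelbergLocalTwistProofs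
import HarnessLib

/-!
# Route IrreducibilityBySelfDuality — `ReciprocityUpToIrreducibilityR` (stmt-Langlands-17925), line `Sketch`:
# GENERIC RIGIDITY of pinned local Langlands data, all ranks, from the printed local facts —
# SHARP form: Henniart 2002 Thm 1.6 (b) in its existence-included transcription (`--supports` file; no definitions)

The crux quantifies over EVERY reciprocity datum `Rec : ReciprocityData K`; the datum enters the
summit's `Corresponds` only through the class `(Rec.llc v).recGL n [π_v]` of a local component
`π_v` of a cuspidal `π`, and local components are generic.  The one hard stub of the line,
`stub_genericRigidity_three_le`, asks that two reciprocity data agree on every GENERIC class of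
every rank at every finite place.  This module proves it (for all ranks `n`, not only `n ≥ 3`)
from the following inputs, all carried as HYPOTHESES spelled out verbatim (nothing unproved is
used, no definition is introduced):

* (h1) the tree's named fact `localLanglands_gl` (Harris–Taylor 2001 Thm. A with Henniart's 1993
  uniqueness on supercuspidal classes), for every non-archimedean local field and normalising pair;
* (h2) **generic preimages** (Harris–Taylor 2001 Thm. A with the Bernstein–Zelevinsky / Zelevinsky
  classification, Henniart 2002 §2.3–§2.7, Zelevinsky 1980 Thm. 9.7): for the canonical normalising
  pair there is a six-clause family `rec₀` under which every INDECOMPOSABLE Frobenius-semisimple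
  parameter `ρ ⊗ Sp_m` is the parameter of a representation generic for every non-trivial `ψ`
  (the generalised Steinberg representations and the supercuspidal ones);
* (h3) Henniart 2002, Thm. 1.7 (a), Galois side (the Literature named fact
  `Henniart2002_isEquivalent_of_rootMultiplicity_eulerFactor_tprod_eq`): a NON-irreducible
  Frobenius-semisimple parameter is determined by the pole orders of its `L`-factors against the
  indecomposable parameters of smaller dimension;
* (h4) Henniart 2002, Thm. 1.6 (b), (ii) ⇒ (i), for generic `π` (Jacquet–Piatetski-Shapiro–Shalika),
  in the EXISTENCE-INCLUDED transcription (the Literature named fact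
  `Henniart2002_isSupercuspidal_of_forall_hasRSLFactor_one`, weaker than the `… → P = 1` form used
  by the sister module `…RGenericRigidityOfFacts`): a generic irreducible `π` of `GL_n(F)`, `n ≥ 2`,
  such that `1` IS a Rankin–Selberg `L`-polynomial of `(π, ρ)` for every generic supercuspidal `ρ`
  of smaller rank (all `ψ`, all invariant measures) is supercuspidal;
* (h5) the invariant measures the clause (iii-L) quantifies over: on every `GL_m(F) ⧸ U_m` there is
  a `GL_m(F)`-invariant Borel measure, finite on compact sets and positive on non-empty open sets.

Proof (`rec_eq_of_isGeneric_of_facts_one`, local; `stub_genericRigidity_of_facts_one`, global) — the same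
induction as the sister module, whose only change is that clause (iii-L) of `rec₀` is read in the
direction `1 = P_{φ₀ ⊗ rec₀[ρ]} → HasRSLFactor … 1` to feed (h4).  Fix the
canonical pair `(d, 𝓔)` of `Rec.llc v`; both `(Rec.llc v).recGL` and `(Rec'.llc v).recGL` are
six-clause families for it (`isLocalLanglandsGL_transport`, landed).  Compare an arbitrary six-clause
family `rec` with `rec₀` of (h2) on generic classes by strong induction on the rank (ranks `0, 1`:
`rec_zero_eq_recGLZero`, `rec_one_eq_recGLOne`).  For a generic `π` of rank `n ≥ 2` let
`φ₀ := rec₀[π]`.  If `φ₀` is NOT irreducible: every indecomposable probe `τ` of dimension `r < n`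
is `rec₀[σ]` with `σ` generic (h2), and `rec[σ] = rec₀[σ]` (induction); instantiating clause
(iii-L) of `rec₀` at its own Galois-side polynomial (right-hand side `rfl`) and reading the
resulting `HasRSLFactor` through clause (iii-L) of `rec` gives `P_{φ₀ ⊗ τ} = P_{rec[π] ⊗ τ}`
(computation-free, inlined), so Thm. 1.7 (a) (h3) gives `φ₀ ≅ rec[π]`.
If `φ₀` IS irreducible: for every generic supercuspidal `ρ` of rank `r < n`, clause (iii-L) of
`rec₀`, read backwards at the Galois-side value `P_{φ₀ ⊗ rec₀[ρ]} = 1` (E1, landed: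
`stub_eulerFactor_tprod_eq_one_of_isIrreducible`), says that `1` IS an `L`-polynomial of `(π, ρ)`,
so `π` is supercuspidal by (h4), and
`rec[π] = rec₀[π]` by the uniqueness half of `localLanglands_gl` (h1), both families being
six-clause families for `(d, 𝓔)`.  Hence `rec = rec₀ = rec'` on generic classes.

No `ε`-factor, no self-dual measure and no Rankin–Selberg value is used.  Standard axioms only; no
`sorry`; no definitions.
-/

noncomputable section

set_option linter.dupNamespace false

open scoped MatrixGroups NumberField Polynomial
open MeasureTheory IsDedekindDomain
open Literature.NumberTheory.Automorphic Literature.NumberTheory.GaloisRepresentations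
open Summit.Langlands

namespace Summit.Langlands.Langlands.Theorems.ReciprocityUpToIrreducibilityR

/-! ## 1. Local comparison of two six-clause families with the same normalising pair -/

section Local

variable {F : Type} [Field F] [ValuativeRel F] [TopologicalSpace F] [IsNonarchimedeanLocalField F]
  {hmul : IsFrobPow.mul (F := F)} {huniq : IsFrobPow.unique (F := F)}
  {hn : absInertia_normal F} {hex : exists_isFrobPow (F := F)}
  {hns : WeilGroup.exists_subgroup_le_inertia_isOpen_of_continuous (F := F)}
  {d : LocalArtinData F} {𝓔 : LocalEpsilonSystem F}
  {rec rec₀ : ∀ n : ℕ, IrrClass (GL (Fin n) F) → Quotient (frobSemisimpleWDSetoid F n)}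

/-- **Local generic rigidity from the printed facts.**  Let `rec₀, rec` be six-clause families for
the same normalising pair `(d, 𝓔)`, where `rec₀` has GENERIC PREIMAGES of indecomposable
parameters (`himg`: Harris–Taylor's correspondence — generalised Steinberg and supercuspidal
representations are generic for every `ψ`).  Granted the named fact `localLanglands_gl` for
`(d, 𝓔)` (`hS09`, Henniart 1993: uniqueness on supercuspidal classes), Henniart 2002 Thm. 1.7 (a)
on the Galois side (`hH`), Henniart 2002 Thm. 1.6 (b) (ii) ⇒ (i) for generic `π` (`hV`) and the
invariant measures on `GL_m(F) ⧸ U_m` (`hν`), the two families agree on every generic class of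
every rank — `hV` in the existence-included form (`HasRSLFactor … 1` as hypothesis).  Strong induction on the rank; ranks `0, 1` by `rec_zero_eq_recGLZero` /
`rec_one_eq_recGLOne`; rank `n ≥ 2`: if `rec₀[π]` is not irreducible, compare Euler factors against
the `rec₀`-parameters of the generic preimages of all indecomposable probes
(`eulerFactor_pair_eq_of_rec_eq` + induction) and apply Thm. 1.7 (a); if it is irreducible, all
`1` is an `L`-polynomial of `π` against every generic supercuspidal `ρ` of smaller rank (clause (iii-L)
of `rec₀` read backwards at E1 `stub_eulerFactor_tprod_eq_one_of_isIrreducible`), so `π` is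
supercuspidal by Thm. 1.6 (b) and the two families agree on `[π]` by `localLanglands_gl`.
[cite: HenniartBSMF2002, Thm. 1.6 (b) and Thm. 1.7 (a)] [cite: HarrisTaylorAMS2001, Thm. A] -/
theorem rec_eq_of_isGeneric_of_facts_one
    (hd : 𝓔.artin F = d) (hS09 : localLanglands_gl F hmul huniq hn hex hns d 𝓔 hd)
    (h₀ : IsLocalLanglandsGL F hmul huniq hn hex hns d 𝓔 rec₀)
    (h : IsLocalLanglandsGL F hmul huniq hn hex hns d 𝓔 rec)
    (himg : ∀ (n : ℕ), 0 < n → ∀ (φ : WeilDeligneRep F ℂ (Fin n → ℂ)) (hφ : φ.IsFrobSemisimple),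
      φ.IsIndecomposable → ∃ π : SmoothIrrep (GL (Fin n) F),
        (∀ ψ : AddChar F Circle, ψ.IsContinuousNontrivial → IsGeneric π.ρ ψ) ∧
          rec₀ n (IrrClass.mk π) = Quotient.mk (frobSemisimpleWDSetoid F n) ⟨φ, hφ⟩)
    (hH : Henniart2002_isEquivalent_of_rootMultiplicity_eulerFactor_tprod_eq F)
    (hV : ∀ (n : ℕ), 2 ≤ n → ∀ (π : SmoothIrrep (GL (Fin n) F)),
      (∃ ψ : AddChar F Circle, ψ.IsContinuousNontrivial ∧ IsGeneric π.ρ ψ) →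
      (∀ (ψ : AddChar F Circle), ψ.IsContinuousNontrivial → IsGeneric π.ρ ψ →
        ∀ (r : ℕ), 0 < r → ∀ (hrn : r < n) (ρ : SmoothIrrep (GL (Fin r) F)),
          ρ.ρ.IsSupercuspidal → IsGeneric ρ.ρ ψ⁻¹ →
          ∀ [MeasurableSpace (GL (Fin r) F ⧸ upperUnitriangular (Fin r) F)]
            [BorelSpace (GL (Fin r) F ⧸ upperUnitriangular (Fin r) F)]
            (ν : Measure (GL (Fin r) F ⧸ upperUnitriangular (Fin r) F))
            [SMulInvariantMeasure (GL (Fin r) F) (GL (Fin r) F ⧸ upperUnitriangular (Fin r) F) ν]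
            [IsFiniteMeasureOnCompacts ν] [ν.IsOpenPosMeasure],
            HasRSLFactor hrn π.ρ ρ.ρ ψ ν 1) →
      π.ρ.IsSupercuspidal)
    (hν : ∀ m : ℕ, ∃ (_ : MeasurableSpace (GL (Fin m) F ⧸ upperUnitriangular (Fin m) F))
      (_ : BorelSpace (GL (Fin m) F ⧸ upperUnitriangular (Fin m) F))
      (ν : Measure (GL (Fin m) F ⧸ upperUnitriangular (Fin m) F)),
      SMulInvariantMeasure (GL (Fin m) F) (GL (Fin m) F ⧸ upperUnitriangular (Fin m) F) ν ∧
      IsFiniteMeasureOnCompacts ν ∧ ν.IsOpenPosMeasure) :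
    ∀ (n : ℕ) (π : SmoothIrrep (GL (Fin n) F)),
      (∃ ψ : AddChar F Circle, ψ.IsContinuousNontrivial ∧ IsGeneric π.ρ ψ) →
        rec n (IrrClass.mk π) = rec₀ n (IrrClass.mk π) := by
  intro n
  induction n using Nat.strong_induction_on with
  | _ n ih =>
    intro π hgen
    rcases Nat.lt_or_ge n 2 with hn2 | hn2
    · interval_cases n
      · rw [h.rec_zero_eq_recGLZero, h₀.rec_zero_eq_recGLZero]
      · rw [h.rec_one_eq_recGLOne, h₀.rec_one_eq_recGLOne]
    · obtain ⟨ψ, hψ, hπ⟩ := hgen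
      by_cases hirr : (rec₀ n (IrrClass.mk π)).out.1.IsIrreducible
      · -- `rec₀[π]` irreducible: `π` is supercuspidal (Thm. 1.6 (b)), then Henniart 1993
        have hsc : π.ρ.IsSupercuspidal := by
          refine hV n hn2 π ⟨ψ, hψ, hπ⟩ ?_
          intro ψ' hψ' hπ' r hr hrn ρ _ hρg _ _ ν _ _ _
          refine (h₀.lFactor_pairs hr hrn π ρ ψ' hψ' hπ' hρg ν 1).2 ?_
          exact (stub_eulerFactor_tprod_eq_one_of_isIrreducible F hn hex (Fin n → ℂ) (Fin r → ℂ)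
            _ _ hirr (by simpa only [Module.finrank_fin_fun] using hrn)).symm
        have hc : (IrrClass.mk π).IsSupercuspidal := (IrrClass.isSupercuspidal_mk π).2 hsc
        exact IsLocalLanglandsGL.unique_of_isSupercuspidal F _ _ _ _ _ hd hS09 h h₀
          (IrrClass.mk π) hc
      · -- `rec₀[π]` not irreducible: Thm. 1.7 (a) against the generic preimages of all probes
        have key : (rec₀ n (IrrClass.mk π)).out.1.IsEquivalent (rec n (IrrClass.mk π)).out.1 := by
          refine Henniart2002_isEquivalent_of_eulerFactor_tprod_indecomposable_eq hH hn hex hn2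
            (rec₀ n (IrrClass.mk π)).out.2 (rec n (IrrClass.mk π)).out.2 hirr ?_
          intro r hr hrn τ hτfs hτind
          obtain ⟨σ, hσgen, hσrec⟩ := himg r hr τ hτfs hτind
          have hσeq : rec r (IrrClass.mk σ) = rec₀ r (IrrClass.mk σ) :=
            ih r hrn σ ⟨ψ, hψ, hσgen ψ hψ⟩
          obtain ⟨_, _, ν, hν1, hν2, hν3⟩ := hν r
          -- computation-free comparison: clause (iii-L) of `rec₀` at its own polynomial, read back through `rec`
          have hcmp : ((rec₀ n (IrrClass.mk π)).out.1.tprod (rec₀ r (IrrClass.mk σ)).out.1).eulerFactor hn hex =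
              ((rec n (IrrClass.mk π)).out.1.tprod (rec₀ r (IrrClass.mk σ)).out.1).eulerFactor hn hex := by
            have h1 := h₀.lFactor_pairs hr hrn π σ ψ hψ hπ (hσgen _ hψ.inv) ν
              (((rec₀ n (IrrClass.mk π)).out.1.tprod (rec₀ r (IrrClass.mk σ)).out.1).eulerFactor hn hex)
            have h2 := h.lFactor_pairs hr hrn π σ ψ hψ hπ (hσgen _ hψ.inv) ν
              (((rec₀ n (IrrClass.mk π)).out.1.tprod (rec₀ r (IrrClass.mk σ)).out.1).eulerFactor hn hex)
            rw [hσeq] at h2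
            exact h2.1 (h1.2 rfl)
          have hτ₀ : (rec₀ r (IrrClass.mk σ)).out.1.IsEquivalent τ := by
            have hout := Quotient.mk_out (s := frobSemisimpleWDSetoid F r) ⟨τ, hτfs⟩
            rw [← hσrec] at hout
            exact hout
          rw [← ReciprocityRigidity.stub_eulerFactor_eq_of_isEquivalent hn hex
              (ReciprocityRigidity.isEquivalent_tprod_right (rec₀ n (IrrClass.mk π)).out.1 hτ₀),
            ← ReciprocityRigidity.stub_eulerFactor_eq_of_isEquivalent hn hex
              (ReciprocityRigidity.isEquivalent_tprod_right (rec n (IrrClass.mk π)).out.1 hτ₀)]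
          exact hcmp
        exact (Quotient.out_equiv_out.1 key).symm

end Local

/-! ## 2. The stub at the level of reciprocity data -/

/-- **Stub S-R (GENERIC RIGIDITY of pinned reciprocity data, all ranks) from the printed local
facts.**  Hypotheses, spelled out verbatim: (h1) the named fact `localLanglands_gl` for every
non-archimedean local field and normalising pair (Harris–Taylor 2001 Thm. A; Henniart 1993
Thm. 1.1); (h2) generic preimages of indecomposable parameters under a six-clause family for the
canonical pair (Harris–Taylor Thm. A with the Zelevinsky classification: generalised Steinberg and
supercuspidal representations are generic for every `ψ`); (h3) Henniart 2002 Thm. 1.7 (a) (Galois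
side, Literature named fact); (h4) Henniart 2002 Thm. 1.6 (b) (ii) ⇒ (i) for generic `π`, existence-included form; (h5)
invariant Radon measures positive on opens on every `GL_m(F) ⧸ U_m`.  Conclusion: two reciprocity
data of a number field agree on every generic class of every rank at every finite place — at `v`
both `(Rec.llc v).recGL` and `(Rec'.llc v).recGL` are six-clause families for the canonical pair of
`Rec.llc v` (`isLocalLanglandsGL_transport`: the pins `llc_isCanonical`, `llc_eps_isCanonical` and
Deligne's uniqueness), and `rec_eq_of_isGeneric_of_facts` compares each with the family of (h2).
[cite: HenniartBSMF2002, Thm. 1.6 (b) and Thm. 1.7 (a)] [cite: HarrisTaylorAMS2001, Thm. A]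
[cite: Henniarts1993, Thm 1.1] -/
theorem stub_genericRigidity_of_facts_one :
    (∀ (F : Type) [Field F] [ValuativeRel F] [TopologicalSpace F] [IsNonarchimedeanLocalField F]
      (hmul : @IsFrobPow.mul F _ _ _ _) (huniq : @IsFrobPow.unique F _ _ _ _)
      (hn : absInertia_normal F) (hex : @exists_isFrobPow F _ _ _ _)
      (hns : @WeilGroup.exists_subgroup_le_inertia_isOpen_of_continuous F _ _ _ _)
      (d : LocalArtinData F) (𝓔 : LocalEpsilonSystem F) (hd : 𝓔.artin F = d),
      localLanglands_gl F hmul huniq hn hex hns d 𝓔 hd) →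
    (∀ (F : Type) [Field F] [ValuativeRel F] [TopologicalSpace F] [IsNonarchimedeanLocalField F]
      (hmul : @IsFrobPow.mul F _ _ _ _) (huniq : @IsFrobPow.unique F _ _ _ _)
      (hn : absInertia_normal F) (hex : @exists_isFrobPow F _ _ _ _)
      (hns : @WeilGroup.exists_subgroup_le_inertia_isOpen_of_continuous F _ _ _ _)
      (d : LocalArtinData F) (𝓔 : LocalEpsilonSystem F), 𝓔.artin F = d →
      (∀ (E : Type) [Field E] [ValuativeRel E] [TopologicalSpace E] [IsNonarchimedeanLocalField E]
        [Algebra F E] [FiniteDimensional F E], (𝓔.artin E).IsCanonical) →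
      ∃ rec : ∀ n : ℕ, IrrClass (GL (Fin n) F) → Quotient (frobSemisimpleWDSetoid F n),
        IsLocalLanglandsGL F hmul huniq hn hex hns d 𝓔 rec ∧
        ∀ (n : ℕ), 0 < n → ∀ (φ : WeilDeligneRep F ℂ (Fin n → ℂ)) (hφ : φ.IsFrobSemisimple),
          φ.IsIndecomposable → ∃ π : SmoothIrrep (GL (Fin n) F),
            (∀ ψ : AddChar F Circle, ψ.IsContinuousNontrivial → IsGeneric π.ρ ψ) ∧
              rec n (IrrClass.mk π) = Quotient.mk (frobSemisimpleWDSetoid F n) ⟨φ, hφ⟩) →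
    (∀ (F : Type) [Field F] [ValuativeRel F] [TopologicalSpace F] [IsNonarchimedeanLocalField F],
      Henniart2002_isEquivalent_of_rootMultiplicity_eulerFactor_tprod_eq F) →
    (∀ (F : Type) [Field F] [ValuativeRel F] [TopologicalSpace F] [IsNonarchimedeanLocalField F]
      (n : ℕ), 2 ≤ n → ∀ (π : SmoothIrrep (GL (Fin n) F)),
      (∃ ψ : AddChar F Circle, ψ.IsContinuousNontrivial ∧ IsGeneric π.ρ ψ) →
      (∀ (ψ : AddChar F Circle), ψ.IsContinuousNontrivial → IsGeneric π.ρ ψ →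
        ∀ (r : ℕ), 0 < r → ∀ (hrn : r < n) (ρ : SmoothIrrep (GL (Fin r) F)),
          ρ.ρ.IsSupercuspidal → IsGeneric ρ.ρ ψ⁻¹ →
          ∀ [MeasurableSpace (GL (Fin r) F ⧸ upperUnitriangular (Fin r) F)]
            [BorelSpace (GL (Fin r) F ⧸ upperUnitriangular (Fin r) F)]
            (ν : Measure (GL (Fin r) F ⧸ upperUnitriangular (Fin r) F))
            [SMulInvariantMeasure (GL (Fin r) F) (GL (Fin r) F ⧸ upperUnitriangular (Fin r) F) ν]
            [IsFiniteMeasureOnCompacts ν] [ν.IsOpenPosMeasure],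
            HasRSLFactor hrn π.ρ ρ.ρ ψ ν 1) →
      π.ρ.IsSupercuspidal) →
    (∀ (F : Type) [Field F] [ValuativeRel F] [TopologicalSpace F] [IsNonarchimedeanLocalField F]
      (m : ℕ), ∃ (_ : MeasurableSpace (GL (Fin m) F ⧸ upperUnitriangular (Fin m) F))
        (_ : BorelSpace (GL (Fin m) F ⧸ upperUnitriangular (Fin m) F))
        (ν : Measure (GL (Fin m) F ⧸ upperUnitriangular (Fin m) F)),
        SMulInvariantMeasure (GL (Fin m) F) (GL (Fin m) F ⧸ upperUnitriangular (Fin m) F) ν ∧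
        IsFiniteMeasureOnCompacts ν ∧ ν.IsOpenPosMeasure) →
    ∀ (K : Type) [Field K] [NumberField K] (Rec Rec' : ReciprocityData K) (v : HeightOneSpectrum (𝓞 K)) (n : ℕ)
      (πv : SmoothIrrep (GL (Fin n) (v.adicCompletion K))) (ψ : AddChar (v.adicCompletion K) Circle),
      ψ.IsContinuousNontrivial → IsGeneric πv.ρ ψ →
        (Rec.llc v).recGL n (IrrClass.mk πv) = (Rec'.llc v).recGL n (IrrClass.mk πv) := by
  intro h1 h2 h3 h4 h5 K _ _ Rec Rec' v n πv ψ hψ hg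
  set L := Rec.llc v with hL
  -- the family of (h2) for the canonical normalising pair of `Rec.llc v`
  obtain ⟨rec₀, hrec₀, himg⟩ := h2 (v.adicCompletion K) L.hmul L.huniq L.hn L.hex L.hns L.artin L.eps
    L.eps_artin (fun E _ _ _ _ _ _ => Rec.llc_eps_isCanonical v E)
  have hS09 := h1 (v.adicCompletion K) L.hmul L.huniq L.hn L.hex L.hns L.artin L.eps L.eps_artin
  -- `Rec` and `Rec'` both agree with `rec₀` on `[πv]`
  have e₁ : L.recGL n (IrrClass.mk πv) = rec₀ n (IrrClass.mk πv) :=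
    rec_eq_of_isGeneric_of_facts_one L.eps_artin hS09 hrec₀ L.isLocalLanglands himg
      (h3 (v.adicCompletion K)) (h4 (v.adicCompletion K)) (h5 (v.adicCompletion K)) n πv ⟨ψ, hψ, hg⟩
  have e₂ : (Rec'.llc v).recGL n (IrrClass.mk πv) = rec₀ n (IrrClass.mk πv) :=
    rec_eq_of_isGeneric_of_facts_one L.eps_artin hS09 hrec₀ (isLocalLanglandsGL_transport Rec Rec' v) himg
      (h3 (v.adicCompletion K)) (h4 (v.adicCompletion K)) (h5 (v.adicCompletion K)) n πv ⟨ψ, hψ, hg⟩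
  rw [e₁, e₂]

end Summit.Langlands.Langlands.Theorems.ReciprocityUpToIrreducibilityR

end
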